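import Literature.NumberTheory.LFunctions.SWLemma1Tools
import Literature.NumberTheory.LFunctions.PrimeReciprocalAP
import HarnessLib

/-!
# Saias–Weingartner 2009, Lemma 1: solving `∑_{p > y} χⱼ(p) e(p) p^{-σ} = wⱼ` continuously

Topic `Literature/NumberTheory/LFunctions` (namespace `Literature.NumberTheory.LFunctions`,
sub-namespace `SaiasWeingartner`). Everything here is PROVED.

**Lemma 1** of [SaiasWeingartner2009] (arXiv:0807.0783, §3): "Let `q` be a positive integer, and
`y` and `R` be positive real numbers. Let `χ₁, …, χₙ` be pairwise distinct Dirichlet characters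
modulo `q`. Then there exists a real `η > 0` such that for all fixed `σ` with `1 < σ ≤ 1 + η`, and
for all prime numbers `p > y`, there exists a continuous function `t_p : D_n(R) → ℝ`, such that
for all `z` in `D_n(R)`, `z = (∑_{p > y} χⱼ(p) p^{-σ - i t_p(z)})_{1 ≤ j ≤ n}`." Only the phases
`p^{-it_p}` are used afterwards, so we produce unit complex numbers `e_w(p)` (`= p^{-it_p(w)}`)
depending continuously on the parameter `w` in the closed polydisc `‖wⱼ‖ ≤ R₁`
(`SW_lemma1`; the sums are written over `ℕ` with the indicator of the primes `p > y`; no lower bound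
on `y` is needed, the primes dividing `q` being killed by `ψⱼ`).

Proof (as printed, with the explicit devices of `SWLemma1Tools.lean`): by orthogonality it
suffices to solve the class equations `∑_{p > y, p ≡ a (q)} e(p) p^{-σ} = W_a`,
`W_a = φ(q)⁻¹ ∑ⱼ ψⱼ⁻¹(a) wⱼ` (`sum_char_mul_charInv_transform`), for every unit `a`; the class sum
`S_a = ∑_{p > y, p ≡ a} p^{-σ}` exceeds `100(nR₁ + 1)` for `1 < σ ≤ 1 + η` (PNT for progressions,
`exists_forall_le_tsum_prime_residue_rpow`); cut the class into three tiers with sums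
`A₀, A₁ ∈ [S_a/3, S_a/3 + 1]`, `A₂ = S_a − A₀ − A₁` (`exists_tiers`) and put `e = 1` on the first
tier, `e = ε₁(W_a − A₀)` on the second and `e = ε₂(W_a − A₀)` on the third, where
`A₁ ε₁(c) + A₂ ε₂(c) = c` is the two-circle linkage (`exists_twoCircle`; the triangle inequalities
hold because `‖W_a‖ ≤ nR₁ ≤ S_a/100`).

## References

* [SaiasWeingartner2009] E. Saias, A. Weingartner, *Zeros of Dirichlet series with periodic
  coefficients*, Acta Arith. 140 (2009), 335–344, Lemma 1 with proof (read, arXiv:0807.0783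
  p. 6).
-/

noncomputable section

open Complex Finset Filter Topology

namespace Literature.NumberTheory.LFunctions

namespace SaiasWeingartner

/-- `n^{-σ}` (complex power, real `σ`) is the real number `n^{-σ}` (a private copy of the tree's
`Literature.Barriers.RiemannHypothesis.natCast_cpow_neg_ofReal`, to keep the imports light).
[folklore] -/
private theorem natCast_cpow_neg_ofReal (n : ℕ) (σ : ℝ) :
    (n : ℂ) ^ (-(σ : ℂ)) = (((n : ℝ) ^ (-σ) : ℝ) : ℂ) := by
  rw [ofReal_cpow n.cast_nonneg, ofReal_natCast, ofReal_neg]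

/-- **Saias–Weingartner 2009, Lemma 1** (unit-phase form). For pairwise distinct Dirichlet
characters `ψⱼ mod q`, any `y` and `R₁ > 0` there is `η > 0` such that for every
`1 < σ ≤ 1 + η` there are unit complex numbers `e_w(n)` (`n ∈ ℕ`), depending continuously on
`w` in the polydisc `‖wⱼ‖ ≤ R₁`, with `∑_{p > y prime} ψⱼ(p) e_w(p) p^{-σ} = wⱼ` for all `j` and
all such `w`. [cite: SaiasWeingartner2009, Lemma 1] -/
theorem SW_lemma1 {q : ℕ} [NeZero q] {ι : Type*} [Fintype ι]
    (ψ : ι → DirichletCharacter ℂ q) (hψ : Function.Injective ψ) (y : ℕ)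
    {R₁ : ℝ} (hR₁ : 0 < R₁) :
    ∃ η : ℝ, 0 < η ∧ ∀ σ : ℝ, 1 < σ → σ ≤ 1 + η →
      ∃ E : (ι → ℂ) → ℕ → ℂ,
        (∀ w : ι → ℂ, (∀ i, ‖w i‖ ≤ R₁) → ∀ n, ‖E w n‖ = 1) ∧
        (∀ n, ContinuousOn (fun w ↦ E w n) {w | ∀ i, ‖w i‖ ≤ R₁}) ∧
        ∀ w : ι → ℂ, (∀ i, ‖w i‖ ≤ R₁) → ∀ i,
          HasSum (fun n : ℕ ↦ if n.Prime ∧ y < n then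
            ψ i n * E w n * (n : ℂ) ^ (-(σ : ℂ)) else 0) (w i) := by
  classical
  set nn : ℕ := Fintype.card ι with hnn
  set K : ℝ := 100 * (nn * R₁ + 1) with hK
  obtain ⟨η, hη, hKle⟩ := exists_forall_le_tsum_prime_residue_rpow q y K
  refine ⟨η, hη, fun σ hσ1 hση ↦ ?_⟩
  -- the class series `u a` and their sums `S a`
  set u : ZMod q → ℕ → ℝ := fun a n ↦
    if n.Prime ∧ y < n ∧ ((n : ℕ) : ZMod q) = a then (n : ℝ) ^ (-σ) else 0 with hu
  have hu0 : ∀ a n, 0 ≤ u a n := fun a n ↦ by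
    simp only [hu]; split_ifs <;> positivity
  have hu1 : ∀ a n, u a n ≤ 1 := fun a n ↦ by
    simp only [hu]
    split_ifs with h
    · exact Real.rpow_le_one_of_one_le_of_nonpos (by exact_mod_cast h.1.one_lt.le) (by linarith)
    · exact zero_le_one
  have husum : ∀ a, Summable (u a) := fun a ↦ summable_prime_residue_rpow a y hσ1
  set S : ZMod q → ℝ := fun a ↦ ∑' n, u a n with hS
  have hSK : ∀ a, IsUnit a → K ≤ S a := fun a ha ↦ hKle σ hσ1 hση a ha
  have hK100 : 100 ≤ K := by
    have : (0 : ℝ) ≤ nn * R₁ := by positivity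
    rw [hK]; nlinarith
  -- tiers
  have htiers : ∀ a : ZMod q, ∃ N : ℕ × ℕ, IsUnit a →
      (N.1 ≤ N.2 ∧ S a / 3 ≤ ∑ n ∈ range N.1, u a n ∧ ∑ n ∈ range N.1, u a n ≤ S a / 3 + 1 ∧
        S a / 3 ≤ ∑ n ∈ Ico N.1 N.2, u a n ∧ ∑ n ∈ Ico N.1 N.2, u a n ≤ S a / 3 + 1) := by
    intro a
    by_cases ha : IsUnit a
    · obtain ⟨N₁, N₂, h⟩ := exists_tiers (hu0 a) (hu1 a) (husum a)
        (hK100.trans (hSK a ha))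
      exact ⟨(N₁, N₂), fun _ ↦ h⟩
    · exact ⟨(0, 0), fun h ↦ (ha h).elim⟩
  choose N hN using htiers
  set A₀ : ZMod q → ℝ := fun a ↦ ∑ n ∈ range (N a).1, u a n with hA₀
  set A₁ : ZMod q → ℝ := fun a ↦ ∑ n ∈ Ico (N a).1 (N a).2, u a n with hA₁
  set A₂ : ZMod q → ℝ := fun a ↦ S a - A₀ a - A₁ a with hA₂
  have hA : ∀ a, IsUnit a → 100 ≤ S a ∧ S a / 3 ≤ A₀ a ∧ A₀ a ≤ S a / 3 + 1 ∧
      S a / 3 ≤ A₁ a ∧ A₁ a ≤ S a / 3 + 1 := fun a ha ↦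
    ⟨hK100.trans (hSK a ha), (hN a ha).2.1, (hN a ha).2.2.1, (hN a ha).2.2.2.1,
      (hN a ha).2.2.2.2⟩
  -- two-circle linkages, one per unit class
  have htc : ∀ a : ZMod q, ∃ ee : (ℂ → ℂ) × (ℂ → ℂ), IsUnit a →
      (ContinuousOn ee.1 {c | c ≠ 0} ∧ ContinuousOn ee.2 {c | c ≠ 0} ∧
        ∀ c : ℂ, c ≠ 0 → |‖c‖ - A₁ a| ≤ A₂ a → A₂ a ≤ ‖c‖ + A₁ a →
          ‖ee.1 c‖ = 1 ∧ ‖ee.2 c‖ = 1 ∧ (A₁ a : ℂ) * ee.1 c + A₂ a * ee.2 c = c) := by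
    intro a
    by_cases ha : IsUnit a
    · obtain ⟨h100, h0l, h0u, h1l, h1u⟩ := hA a ha
      have hA₁0 : 0 < A₁ a := by linarith
      have hA₂0 : 0 < A₂ a := by simp only [hA₂]; linarith
      obtain ⟨e1, e2, h⟩ := exists_twoCircle hA₁0 hA₂0
      exact ⟨(e1, e2), fun _ ↦ h⟩
    · exact ⟨(fun _ ↦ 0, fun _ ↦ 0), fun h ↦ (ha h).elim⟩
  choose ee hee using htc
  -- the transform and the targets
  set W : (ι → ℂ) → ZMod q → ℂ := fun w a ↦ (q.totient : ℂ)⁻¹ * ∑ j, (ψ j)⁻¹ a * w j with hW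
  set cc : (ι → ℂ) → ZMod q → ℂ := fun w a ↦ W w a - (A₀ a : ℂ) with hcc
  have hWcont : ∀ a, Continuous fun w ↦ W w a := fun a ↦ by
    simp only [hW]; fun_prop
  have hcccont : ∀ a, Continuous fun w ↦ cc w a := fun a ↦ (hWcont a).sub continuous_const
  have hWle : ∀ w : ι → ℂ, (∀ i, ‖w i‖ ≤ R₁) → ∀ a, ‖W w a‖ ≤ nn * R₁ := by
    intro w hw a
    refine (norm_charInv_transform_le ψ w a).trans ?_
    calc ∑ j, ‖w j‖ ≤ ∑ _j : ι, R₁ := Finset.sum_le_sum fun j _ ↦ hw j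
      _ = nn * R₁ := by rw [Finset.sum_const, Finset.card_univ, nsmul_eq_mul]
  -- the triangle inequalities on the polydisc
  have htri : ∀ w : ι → ℂ, (∀ i, ‖w i‖ ≤ R₁) → ∀ a, IsUnit a →
      cc w a ≠ 0 ∧ |‖cc w a‖ - A₁ a| ≤ A₂ a ∧ A₂ a ≤ ‖cc w a‖ + A₁ a := by
    intro w hw a ha
    obtain ⟨h100, h0l, h0u, h1l, h1u⟩ := hA a ha
    have hWa : ‖W w a‖ ≤ S a / 100 := by
      refine (hWle w hw a).trans ?_
      have := hSK a ha
      rw [hK] at this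
      linarith
    have hA₀n : ‖(A₀ a : ℂ)‖ = A₀ a := by
      rw [Complex.norm_real, Real.norm_eq_abs, abs_of_nonneg (by linarith)]
    have hlow : A₀ a - S a / 100 ≤ ‖cc w a‖ := by
      have := norm_sub_norm_le (A₀ a : ℂ) (W w a)
      rw [hA₀n, norm_sub_rev] at this
      simp only [hcc]
      linarith
    have hup : ‖cc w a‖ ≤ A₀ a + S a / 100 := by
      have := norm_sub_le (W w a) (A₀ a : ℂ)
      rw [hA₀n] at this
      simp only [hcc]
      linarith
    refine ⟨?_, ?_, ?_⟩
    · rw [← norm_pos_iff]; linarith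
    · rw [abs_le]; simp only [hA₂]; constructor <;> linarith
    · simp only [hA₂]; linarith
  -- the twist
  set E : (ι → ℂ) → ℕ → ℂ := fun w n ↦
    if n.Prime ∧ y < n ∧ IsUnit ((n : ℕ) : ZMod q) then
      (if n < (N (n : ZMod q)).1 then 1
        else if n < (N (n : ZMod q)).2 then (ee (n : ZMod q)).1 (cc w (n : ZMod q))
        else (ee (n : ZMod q)).2 (cc w (n : ZMod q)))
    else 1 with hE
  refine ⟨E, ?_, ?_, ?_⟩
  · -- unit norm
    intro w hw n
    simp only [hE]
    split_ifs with h h1 h2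
    · exact norm_one
    · obtain ⟨hc, ht1, ht2⟩ := htri w hw _ h.2.2
      exact ((hee _ h.2.2).2.2 _ hc ht1 ht2).1
    · obtain ⟨hc, ht1, ht2⟩ := htri w hw _ h.2.2
      exact ((hee _ h.2.2).2.2 _ hc ht1 ht2).2.1
    · exact norm_one
  · -- continuity
    intro n
    by_cases h : n.Prime ∧ y < n ∧ IsUnit ((n : ℕ) : ZMod q)
    · have hmaps : Set.MapsTo (fun w : ι → ℂ ↦ cc w (n : ZMod q)) {w | ∀ i, ‖w i‖ ≤ R₁}
          {c : ℂ | c ≠ 0} := fun w hw ↦ (htri w hw _ h.2.2).1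
      by_cases h1 : n < (N (n : ZMod q)).1
      · simp only [hE, if_pos h, if_pos h1]; exact continuousOn_const
      by_cases h2 : n < (N (n : ZMod q)).2
      · simp only [hE, if_pos h, if_neg h1, if_pos h2]
        exact (hee _ h.2.2).1.comp (hcccont _).continuousOn hmaps
      · simp only [hE, if_pos h, if_neg h1, if_neg h2]
        exact (hee _ h.2.2).2.1.comp (hcccont _).continuousOn hmaps
    · simp only [hE, if_neg h]; exact continuousOn_const
  · -- the sums
    intro w hw i
    -- class by class
    set t : ZMod q → ℕ → ℂ := fun a n ↦
      if n.Prime ∧ y < n ∧ ((n : ℕ) : ZMod q) = a then E w n * (n : ℂ) ^ (-(σ : ℂ)) else 0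
      with ht
    have hnorm_t : ∀ a n, ‖t a n‖ ≤ u a n := by
      intro a n
      simp only [ht, hu]
      split_ifs with h
      · rw [norm_mul, natCast_cpow_neg_ofReal, Complex.norm_real, Real.norm_eq_abs,
          abs_of_nonneg (by positivity)]
        have hE1 : ‖E w n‖ ≤ 1 := by
          simp only [hE]
          split_ifs with h' h1 h2
          · simp
          · obtain ⟨hc, ht1, ht2⟩ := htri w hw _ h'.2.2
            exact ((hee _ h'.2.2).2.2 _ hc ht1 ht2).1.le
          · obtain ⟨hc, ht1, ht2⟩ := htri w hw _ h'.2.2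
            exact ((hee _ h'.2.2).2.2 _ hc ht1 ht2).2.1.le
          · simp
        exact mul_le_of_le_one_left (by positivity) hE1
      · simp
    have htsum : ∀ a, Summable (t a) := fun a ↦
      Summable.of_norm_bounded (husum a) (hnorm_t a)
    -- the class sums of units
    have hclass : ∀ a, IsUnit a → ∑' n, t a n = W w a := by
      intro a ha
      obtain ⟨hle, -⟩ := hN a ha
      obtain ⟨hc, ht1, ht2⟩ := htri w hw a ha
      obtain ⟨hn1, hn2, heq⟩ := (hee a ha).2.2 _ hc ht1 ht2
      set ε₁ : ℂ := (ee a).1 (cc w a) with hε₁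
      set ε₂ : ℂ := (ee a).2 (cc w a) with hε₂
      -- coefficient by position
      set κ : ℕ → ℂ := fun n ↦ if n < (N a).1 then 1 else if n < (N a).2 then ε₁ else ε₂ with hκ
      have htκ : ∀ n, t a n = κ n * (u a n : ℂ) := by
        intro n
        simp only [ht, hu]
        by_cases h : n.Prime ∧ y < n ∧ ((n : ℕ) : ZMod q) = a
        · rw [if_pos h, if_pos h, natCast_cpow_neg_ofReal]
          have hunit : IsUnit ((n : ℕ) : ZMod q) := h.2.2 ▸ ha
          have hEn : E w n = κ n := by
            simp only [hE, if_pos (show n.Prime ∧ y < n ∧ IsUnit ((n : ℕ) : ZMod q) from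
              ⟨h.1, h.2.1, hunit⟩), hκ, h.2.2]
            rfl
          rw [hEn]
        · rw [if_neg h, if_neg h]
          simp
      have hκsum : Summable fun n ↦ κ n * (u a n : ℂ) := by
        rw [show (fun n ↦ κ n * (u a n : ℂ)) = t a from (funext htκ).symm]
        exact htsum a
      rw [tsum_congr htκ, ← hκsum.sum_add_tsum_nat_add (N a).2]
      -- the head
      have hhead : ∑ n ∈ range (N a).2, κ n * (u a n : ℂ) = (A₀ a : ℂ) + ε₁ * (A₁ a : ℂ) := by
        rw [← sum_range_add_sum_Ico _ hle]
        congr 1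
        · rw [hA₀, ofReal_sum]
          refine Finset.sum_congr rfl fun n hn ↦ ?_
          rw [hκ]; dsimp only
          rw [if_pos (mem_range.1 hn), one_mul]
        · rw [hA₁, ofReal_sum, Finset.mul_sum]
          refine Finset.sum_congr rfl fun n hn ↦ ?_
          obtain ⟨hn1, hn2⟩ := mem_Ico.1 hn
          rw [hκ]; dsimp only
          rw [if_neg (not_lt.2 hn1), if_pos hn2]
      -- the tail
      have htail : ∑' n, κ (n + (N a).2) * (u a (n + (N a).2) : ℂ) = ε₂ * (A₂ a : ℂ) := by
        have e : ∀ n, κ (n + (N a).2) * (u a (n + (N a).2) : ℂ) =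
            ε₂ * (u a (n + (N a).2) : ℂ) := by
          intro n
          rw [hκ]; dsimp only
          rw [if_neg (by omega), if_neg (by omega)]
        rw [tsum_congr e, tsum_mul_left, ← ofReal_tsum]
        congr 2
        have := (husum a).sum_add_tsum_nat_add (N a).2
        rw [← sum_range_add_sum_Ico _ hle] at this
        simp only [hA₂, hS, hA₀, hA₁]
        linarith
      rw [hhead, htail]
      -- `A₀ + A₁ ε₁ + A₂ ε₂ = A₀ + cc = W`
      have : (A₁ a : ℂ) * ε₁ + (A₂ a : ℂ) * ε₂ = cc w a := heq
      simp only [hcc] at this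
      linear_combination this
    -- assembling over the classes
    have hdecomp : ∀ n : ℕ, (if n.Prime ∧ y < n then ψ i n * E w n * (n : ℂ) ^ (-(σ : ℂ)) else 0)
        = ∑ a : ZMod q, ψ i a * t a n := by
      intro n
      by_cases h : n.Prime ∧ y < n
      · rw [if_pos h]
        have e : ∀ a : ZMod q, ψ i a * t a n =
            if ((n : ℕ) : ZMod q) = a then ψ i a * (E w n * (n : ℂ) ^ (-(σ : ℂ))) else 0 := by
          intro a
          simp only [ht]
          by_cases h' : ((n : ℕ) : ZMod q) = a
          · rw [if_pos ⟨h.1, h.2, h'⟩, if_pos h']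
          · rw [if_neg (fun hh ↦ h' hh.2.2), if_neg h', mul_zero]
        rw [Finset.sum_congr rfl fun a _ ↦ e a, Finset.sum_ite_eq]
        simp only [Finset.mem_univ, if_true]
        ring
      · rw [if_neg h]
        refine (Finset.sum_eq_zero fun a _ ↦ ?_).symm
        simp only [ht,
          if_neg (fun hh : n.Prime ∧ y < n ∧ ((n : ℕ) : ZMod q) = a ↦ h ⟨hh.1, hh.2.1⟩), mul_zero]
    have hsum : HasSum (fun n : ℕ ↦ ∑ a : ZMod q, ψ i a * t a n)
        (∑ a : ZMod q, ψ i a * ∑' n, t a n) :=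
      hasSum_sum fun a _ ↦ (htsum a).hasSum.mul_left _
    have hval : ∑ a : ZMod q, ψ i a * ∑' n, t a n = w i := by
      have e : ∀ a : ZMod q, ψ i a * ∑' n, t a n = ψ i a * W w a := by
        intro a
        by_cases ha : IsUnit a
        · rw [hclass a ha]
        · rw [MulChar.map_nonunit _ ha, zero_mul, zero_mul]
      rw [Finset.sum_congr rfl fun a _ ↦ e a]
      exact sum_char_mul_charInv_transform ψ hψ w i
    rw [← hval]
    simpa only [hdecomp] using hsum

end SaiasWeingartner

end Literature.NumberTheory.LFunctions
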